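/-
Origin: expansion seat `prover-pub-hodgecm-mc-carch-1-g3-0`, handover #CA20 2026-08-20T06:40Z md5 4dc33424734f (501 l., 22 decls; NEW additive leaf; imports installed Model.ArchLineDatumOf (F1) + HypCensus.DefiniteVacuumExponent + HypCensus.KInfLetters (RUN 41) + Model.ArchKTypeOfLines + Model.ArchKTypePinTensor; RUN 42; smokable NOW over the RUN-41 world; drop-alone; cert certs/ax-ArchKTypeOfDefinite-4dc33424734f.log: rc 0 / 67 s / 0 warnings / 22/22 trio) (`HOME/mc/pub-hodgecm-mc-carch-1/pkg42/HodgeCM/Model/ArchKTypeOfDefinite.lean`, md5 4dc33424734f, 501 lines);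
landed by the second packager p2 gen 3 (p2-g3) in gate run 42 as `HodgeCM/Model/ArchKTypeOfDefinite.lean` (verbatim).
-/
/-
Copyright (c) 2026. Released under Apache 2.0 license as described in the file LICENSE.
Cell pub-hodgecm, MODEL layer (construction prover mc-carch-1, gen 3), BINDER-OWNERS row 12 `C`, input (c5) `harch`: the junction «the harmonic
family of the row-12 term is THE VACUUM at every definite place», and the compact definite factors' action on it by ONE power of `det`.
-/
import Summits.HodgeConjecture.HodgeCM.Model.ArchLineDatumOf_3
import Summits.HodgeConjecture.HodgeCM.Model.HypCensus.DefiniteVacuumExponent_2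
import Summits.HodgeConjecture.HodgeCM.Model.HypCensus.KInfLetters
import Summits.HodgeConjecture.HodgeCM.Model.ArchKTypeOfLines
import Summits.HodgeConjecture.HodgeCM.Model.ArchKTypePinTensor

/-!
# The harmonic family at the definite places: frame image, and the `det`-power action (junction for (c5) `harch`)

The row-12 term (#CA13–#CA19) carries the harmonic family `Φarch ℓ := blockFamilyOfAt … eR eS (degOnePDual S') (binvPi 1) ℓ` — the degree-one
vector at `v₁` tensored with the VACUUM at every other real place (theta-3 (F1) `blockFamilyOfAt_degOnePDual_binvPi_one`: it is the Folland–Fock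
vector of the line's place polynomial, which lives at `v₁` only).  discharge-4's census item (c5) (`HypCensus/DefiniteVacuumExponent`,
`exists_exponent_of_signs`) says: at a real place `b` not under `ι₁` the compact group `U(σ_{w(b)} diag d_V)(ℂ)` acts through binder-2's
`cmArchWeilRep` on every vector whose canonical-frame image is `B⁻¹G` with `G` free of `b` by ONE power `det(u)^{a b}`.  This file joins the two:

* § 1 `schwartzTransport_cmBigFrame_blockFamilyOfAt` — the canonical-frame image of `Φarch ⟨b', ·⟩` is `B⁻¹(∏_w linePlacePoly b' w)`;
  `snd_eq_of_mem_vars_prod_linePlacePoly` — that polynomial has all its variables at the place `v₁` (so it is free of every `b ≠ v₁`);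
* § 2 **`exists_defExponent_blockFamilyOfAt`** — for the LINE pair `(diag (frameD V), ⟨d⟩)` (any real non-zero `d`, its splitting `hGRd`; the
  sign facts are theorems: `frameD_sign_ι₁'`, `frameD_sign_of_ne`, (F1) `lineVec_sign`, `lineVec_sign_of_ne`): ONE `a : {v real} → ℤ` with
  `cmArchWeilRep … (archSingle (w b) u, 1) (Φarch ℓ) = det(u)^{a b} • Φarch ℓ` for every `b` not under `ι₁`, every `u`, every covector `ℓ`.

* § 3 (generic, any `U(H)(L ⊗ ℝ)`, any action `ω : arch →* End X`, any scalar `χ : arch →* ℂˣ`) `placeTrunc` / `placeTrunc_insert` (an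
  archimedean element is the product of its one-place components, peeled place by place through `archPiEquiv`) and
  **`smul_apply_eq_self_of_places`**: if `x` is trivial at the complex place `w₁` and at every real place `b` not under `w₁` the one-place
  elements satisfy `χ(s) • ω(s) Φ = Φ`, then `χ(x) • ω(x) Φ = Φ`;
* § 4 at the pin (`V.Hm` framed by `frameG V`, period-1's `lineRepD`): `archScalar_zero/one` (the line scalar `x ↦ η_k(x^𝔸,1)·χ_k(x^𝔸,1)` on
  `U(diag frameD V)(L ⊗ ℝ)`; #CA3's `lineScalar_k` is its pull-back along the `ι₁`-section), `lineRepD_zero/one_regime_archToAdelic`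
  (`lineRepD k ((a)^𝔸_regime, 1) = (c_k(a′) • ω_∞(a′, 1)) ⊗ 1`, `a′ = archFrameCongr (frameG V) a`; #CA2 + the line collapse),
  `archAt_archFrameCongr_eq_one`, and **`harch_zero_of_defType` / `harch_one_of_defType`**: from the definite TYPE identity
  `hdef : ∀ b ≠ v₁, ∀ u, c_k(archSingle (w b) u) · det(u)^{a b} = 1` (with `a` the exponent function of § 2, passed as `hω`) follows
  LITERALLY the `harchₖ` input of the row-12 term (#CA13–#CA19): every `aa ∈ U(V.Hm)(L ⊗ ℝ)` with `archAt (w ι₁) aa = 1` fixes every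
  `φ_N(Φarch ℓ)` under `lineRepD … k`.

So the (c5) input `harchₖ` of the row-12 term IS REDUCED to the archimedean TYPE of the line scalar `c_k = η_k · χ_k` at the definite places —
an (S-norm) statement about the S pin's `η` (for sinst-1's `η := EtaChi.η χV χW`: about `archType χV` at the definite places), not about the
harmonic family.  Nothing is cited here and nothing is minted: kernel lemmas over installed RUN-36/39/41 modules; 0 records, 0 `def … : Prop`.
-/

set_option autoImplicit false

noncomputable section

open NumberField NumberField.InfinitePlace NumberField.mixedEmbedding IsDedekindDomain
open scoped Matrix TensorProduct Classical SchwartzMap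
open MvPolynomial
open Literature.AlgebraicGeometry.HodgeTheory
open Literature.NumberTheory.Automorphic Literature.NumberTheory.Automorphic.UnitaryGroup Literature.NumberTheory.Weil1964
open Literature.RepresentationTheory.KonnoKonno2007 Literature.RepresentationTheory.KonnoKonno2007.RealDualPair
open Literature.NumberTheory.GelbartRogawski1991 Literature.NumberTheory.GelbartRogawski1991.UnitaryDualPair
open Literature.RepresentationTheory (atPlace)
open Literature.Analysis.SegalBargmann
open HodgeCM.Adelic HodgeCM.PerL34 HodgeCM.Model.HypCensus HodgeCM.Model.SupplyInstance HodgeCM.Model.ArchSideTerm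

namespace HodgeCM.Model

/-! ## § 1 The canonical-frame image of the harmonic family -/

section FrameImage

variable (S' : Type) [Fintype S'] [DecidableEq S']
variable (L : Type) [Field L] [NumberField L] [IsCMField L] {N M n : ℕ} (e : Fin N × Fin M ≃ Fin n)
variable (dV : Fin N → L) (hdV : ∀ i, IsCMField.complexConj L (dV i) = dV i) (hdV0 : ∀ i, dV i ≠ 0)
variable (dW : Fin M → L) (hdW : ∀ i, IsCMField.complexConj L (dW i) = dW i) (hdW0 : ∀ i, dW i ≠ 0) (ι₁ : L →+* ℂ)
variable (eP : PosIdx (cmXV L dV hdV ι₁ (HypCensus.cmPlace L ι₁)) ≃ Fin 2) (eQ : NegIdx (cmXV L dV hdV ι₁ (HypCensus.cmPlace L ι₁)) ≃ Unit)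
  (eR : PosIdx (cmXW L dV dW hdW ι₁ (HypCensus.cmPlace L ι₁)) ≃ Unit) (eS : NegIdx (cmXW L dV dW hdW ι₁ (HypCensus.cmPlace L ι₁)) ≃ S')

/-- **the canonical-frame image of the harmonic family at the covector `⟨b', ·⟩` is `B⁻¹(∏_w linePlacePoly b' w)`** ((F1) + `schwartzTransport_follandFock`). -/
theorem schwartzTransport_cmBigFrame_blockFamilyOfAt (b' : Fin 2 → ℂ) :
    schwartzTransport (cmBigFrame L e dV hdV hdV0 dW hdW hdW0 ι₁)
        (blockFamilyOfAt L e dV hdV hdV0 dW hdW hdW0 ι₁ eP eQ eR eS (degOnePDual S') (binvPi 1) (dotProductEquiv ℂ (Fin 2) b')) =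
      binvPi (∏ w, rename (atPlace w) (linePlacePoly S' L e dV hdV dW hdW ι₁ eP eQ eR eS b' w)) := by
  rw [blockFamilyOfAt_degOnePDual_binvPi_one, schwartzTransport_follandFock]

omit [DecidableEq S'] in
/-- the place product of the line's polynomials has all its variables AT `v₁`. -/
theorem snd_eq_of_mem_vars_prod_linePlacePoly (b' : Fin 2 → ℂ)
    {x : Fin n × {v : InfinitePlace ↥(maximalRealSubfield L) // v.IsReal}}
    (hx : x ∈ (∏ w, rename (atPlace w) (linePlacePoly S' L e dV hdV dW hdW ι₁ eP eQ eR eS b' w)).vars) :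
    x.2 = HypCensus.cmPlace L ι₁ := by
  rw [prod_linePlacePoly] at hx
  obtain ⟨i, -, rfl⟩ := Finset.mem_image.1 (vars_rename _ _ hx)
  rfl

omit [DecidableEq S'] in
/-- … hence it is free of every real place `b ≠ v₁`. -/
theorem snd_ne_of_mem_vars_prod_linePlacePoly (b' : Fin 2 → ℂ) {b : {v : InfinitePlace ↥(maximalRealSubfield L) // v.IsReal}}
    (hb : b ≠ HypCensus.cmPlace L ι₁) :
    ∀ x ∈ (∏ w, rename (atPlace w) (linePlacePoly S' L e dV hdV dW hdW ι₁ eP eQ eR eS b' w)).vars, x.2 ≠ b :=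
  fun _ hx h => hb (h.symm.trans (snd_eq_of_mem_vars_prod_linePlacePoly S' L e dV hdV dW hdW ι₁ eP eQ eR eS b' hx))

end FrameImage

/-! ## § 2 The compact definite factors act on the harmonic family by one power of `det` -/

section DefExponent

variable (S' : Type) [Fintype S'] [DecidableEq S']
variable {L : CMField} {ι₁ : L →+* ℂ} (V : HermSpace3 L ι₁)
variable (d : (L : Type)) (hd : IsCMField.complexConj L d = d) (hd0 : d ≠ 0)
  (hGRd : (cmSplittingDatum (L : Type) (e₁) (frameD V) (frameD_real V) (frameD_ne V) (lineVec (L : Type) d) (fun _ => hd)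
    (fun _ => hd0)).CompatibleSplitting)
variable (eR : PosIdx (cmXW (L : Type) (frameD V) (lineVec (L : Type) d) (fun _ => hd) ι₁ (HypCensus.cmPlace (L : Type) ι₁)) ≃ Unit)
  (eS : NegIdx (cmXW (L : Type) (frameD V) (lineVec (L : Type) d) (fun _ => hd) ι₁ (HypCensus.cmPlace (L : Type) ι₁)) ≃ S')

/-- a real place of `L⁺` other than `cmPlace ι₁` is not under `ι₁`. -/
theorem ne_comap_of_ne_cmPlace {b : {v : InfinitePlace ↥(maximalRealSubfield L) // v.IsReal}}
    (hb : b ≠ HypCensus.cmPlace (L : Type) ι₁) : b.1 ≠ (InfinitePlace.mk ι₁).comap (algebraMap (↥(maximalRealSubfield L)) L) :=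
  fun h => hb (Subtype.ext h)

/-- **THE DEFINITE FACTORS ACT ON THE HARMONIC FAMILY BY ONE POWER OF `det`.**  For the line pair `(diag (frameD V), ⟨d⟩)` there is ONE
exponent function `a : {v real} → ℤ` (discharge-4 `exists_exponent_of_signs`, sign facts discharged) such that at every real place
`b ≠ v₁`, for every `u ∈ U(σ_{w(b)} diag (frameD V))(ℂ)` and every covector `ℓ`:
`cmArchWeilRep … (archSingle (w b) u, 1) (Φarch ℓ) = det(u)^{a b} • Φarch ℓ`, `Φarch ℓ := blockFamilyOfAt … eR eS (degOnePDual S') (binvPi 1) ℓ`.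
[KonnoKonno2007 §3.1 (3.1); Folland1989 Prop. (4.39); GelbartRogawski1991 §3.1 Prop. 3.1.1 — via the installed census leaf] -/
theorem exists_defExponent_blockFamilyOfAt :
    ∃ a : {v : InfinitePlace ↥(maximalRealSubfield L) // v.IsReal} → ℤ,
      ∀ b : {v : InfinitePlace ↥(maximalRealSubfield L) // v.IsReal}, b ≠ HypCensus.cmPlace (L : Type) ι₁ →
        ∀ (u : archLocal (L : Type) 3 (Matrix.diagonal (frameD V)) (cmPlaceOver (L : Type) b)) (ℓ : Module.Dual ℂ (Fin 2 → ℂ)),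
          cmArchWeilRep (L : Type) e₁ (frameD V) (frameD_real V) (frameD_ne V) (lineVec (L : Type) d) (fun _ => hd) (fun _ => hd0) hGRd
              (UnitaryGroup.archSingle (↥(maximalRealSubfield L)) L (IsCMField.complexConj L) 3 (Matrix.diagonal (frameD V))
                (IsCMField.complexConj_ne_one L) (UnitaryGroup.complexConj_smul_infinitePlace (L : Type)) (cmPlaceOver (L : Type) b) u, 1)
              (blockFamilyOfAt (L : Type) e₁ (frameD V) (frameD_real V) (frameD_ne V) (lineVec (L : Type) d) (fun _ => hd) (fun _ => hd0) ι₁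
                (blockPosEquiv V) (blockNegEquiv V) eR eS (degOnePDual S') (binvPi 1) ℓ) =
            (((u : archLocal (L : Type) 3 (Matrix.diagonal (frameD V)) (cmPlaceOver (L : Type) b)) : GL (Fin 3) ℂ) :
                Matrix (Fin 3) (Fin 3) ℂ).det ^ a b •
              blockFamilyOfAt (L : Type) e₁ (frameD V) (frameD_real V) (frameD_ne V) (lineVec (L : Type) d) (fun _ => hd) (fun _ => hd0) ι₁
                (blockPosEquiv V) (blockNegEquiv V) eR eS (degOnePDual S') (binvPi 1) ℓ := by
  obtain ⟨a, ha⟩ := exists_exponent_of_signs (L : Type) e₁ (frameD V) (frameD_real V) (frameD_ne V) (lineVec (L : Type) d) (fun _ => hd)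
    (fun _ => hd0) hGRd ι₁ (frameD_sign_ι₁' V) (lineVec_sign (L : Type) ι₁ d hd hd0) (frameD_sign_of_ne V)
    (fun τ hτ => lineVec_sign_of_ne (L : Type) ι₁ d τ hτ)
  refine ⟨a, fun b hb u ℓ => ?_⟩
  have hℓ : ℓ = dotProductEquiv ℂ (Fin 2) ((dotProductEquiv ℂ (Fin 2)).symm ℓ) := ((dotProductEquiv ℂ (Fin 2)).apply_symm_apply ℓ).symm
  rw [hℓ]
  exact ha b (ne_comap_of_ne_cmPlace hb) u _
    (snd_ne_of_mem_vars_prod_linePlacePoly S' (L : Type) e₁ (frameD V) (frameD_real V) (lineVec (L : Type) d) (fun _ => hd) ι₁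
      (blockPosEquiv V) (blockNegEquiv V) eR eS _ hb) _
    (schwartzTransport_cmBigFrame_blockFamilyOfAt S' (L : Type) e₁ (frameD V) (frameD_real V) (frameD_ne V) (lineVec (L : Type) d)
      (fun _ => hd) (fun _ => hd0) ι₁ (blockPosEquiv V) (blockNegEquiv V) eR eS _)

end DefExponent

/-! ## § 3 Place-by-place induction: an archimedean element trivial at `w₁` acts through its definite components -/

section PlaceInduction

variable (L : Type) [Field L] [NumberField L] [IsCMField L] {N : ℕ} (H : Matrix (Fin N) (Fin N) L)

/-- the real place under a chosen complex place is the place itself. -/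
theorem cmPlaceUnder_cmPlaceOver (b : {v : InfinitePlace ↥(maximalRealSubfield L) // v.IsReal}) :
    cmPlaceUnder L (cmPlaceOver L b) = b :=
  Subtype.ext (cmPlaceOver_comap L b)

/-- **truncation to a set of places**: keep the components of `x` over the real places in `T`, put `1` elsewhere. -/
def placeTrunc (x : UnitaryGroup.arch (↥(maximalRealSubfield L)) L (IsCMField.complexConj L) N H)
    (T : Finset {v : InfinitePlace ↥(maximalRealSubfield L) // v.IsReal}) :
    UnitaryGroup.arch (↥(maximalRealSubfield L)) L (IsCMField.complexConj L) N H :=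
  (UnitaryGroup.archPiEquiv (↥(maximalRealSubfield L)) L (IsCMField.complexConj L) N H (IsCMField.complexConj_ne_one L)
      (NumberField.complexConj_smul_infinitePlace L)).symm
    fun w => if cmPlaceUnder L w ∈ T then
      UnitaryGroup.archPiEquiv (↥(maximalRealSubfield L)) L (IsCMField.complexConj L) N H (IsCMField.complexConj_ne_one L)
        (NumberField.complexConj_smul_infinitePlace L) x w else 1

/-- (Ported verbatim from the HodgeCMPerL package; no docstring in the source.) -/
theorem placeTrunc_univ (x : UnitaryGroup.arch (↥(maximalRealSubfield L)) L (IsCMField.complexConj L) N H) :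
    placeTrunc L H x Finset.univ = x := by
  unfold placeTrunc
  have h : (fun w : {w : InfinitePlace L // w.IsComplex} => if cmPlaceUnder L w ∈ (Finset.univ : Finset _) then
      UnitaryGroup.archPiEquiv (↥(maximalRealSubfield L)) L (IsCMField.complexConj L) N H (IsCMField.complexConj_ne_one L)
        (NumberField.complexConj_smul_infinitePlace L) x w else 1) =
      UnitaryGroup.archPiEquiv (↥(maximalRealSubfield L)) L (IsCMField.complexConj L) N H (IsCMField.complexConj_ne_one L)
        (NumberField.complexConj_smul_infinitePlace L) x := funext fun w => if_pos (Finset.mem_univ _)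
  rw [h, ContinuousMulEquiv.symm_apply_apply]

/-- (Ported verbatim from the HodgeCMPerL package; no docstring in the source.) -/
theorem placeTrunc_empty (x : UnitaryGroup.arch (↥(maximalRealSubfield L)) L (IsCMField.complexConj L) N H) :
    placeTrunc L H x ∅ = 1 := by
  unfold placeTrunc
  have h : (fun w : {w : InfinitePlace L // w.IsComplex} => if cmPlaceUnder L w ∈ (∅ : Finset _) then
      UnitaryGroup.archPiEquiv (↥(maximalRealSubfield L)) L (IsCMField.complexConj L) N H (IsCMField.complexConj_ne_one L)
        (NumberField.complexConj_smul_infinitePlace L) x w else 1) = 1 := funext fun w => if_neg (Finset.notMem_empty _)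
  rw [h, map_one]

/-- peeling one place: `x_{b ∪ T} = (x_b at w(b)) · x_T`. -/
theorem placeTrunc_insert (x : UnitaryGroup.arch (↥(maximalRealSubfield L)) L (IsCMField.complexConj L) N H)
    {b : {v : InfinitePlace ↥(maximalRealSubfield L) // v.IsReal}} {T : Finset {v : InfinitePlace ↥(maximalRealSubfield L) // v.IsReal}}
    (hb : b ∉ T) :
    placeTrunc L H x (insert b T) =
      UnitaryGroup.archSingle (↥(maximalRealSubfield L)) L (IsCMField.complexConj L) N H (IsCMField.complexConj_ne_one L)
          (NumberField.complexConj_smul_infinitePlace L) (cmPlaceOver L b)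
          (UnitaryGroup.archAt (↥(maximalRealSubfield L)) L (IsCMField.complexConj L) N H (cmPlaceOver L b)
            (NumberField.complexConj_smul_infinitePlace L _) (IsCMField.complexConj_ne_one L) x) *
        placeTrunc L H x T := by
  rw [UnitaryGroup.archSingle_apply, placeTrunc, placeTrunc, ← map_mul]
  congr 1
  funext w
  rw [Pi.mul_apply]
  by_cases hw : w = cmPlaceOver L b
  · subst hw
    rw [Pi.mulSingle_eq_same, cmPlaceUnder_cmPlaceOver, if_pos (Finset.mem_insert_self _ _), if_neg hb, mul_one,
      UnitaryGroup.archPiEquiv_apply]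
  · have hne : cmPlaceUnder L w ≠ b := fun h => hw (by rw [← h, cmPlaceOver_cmPlaceUnder])
    rw [Pi.mulSingle_eq_of_ne hw, one_mul]
    by_cases hT : cmPlaceUnder L w ∈ T
    · rw [if_pos hT, if_pos (Finset.mem_insert_of_mem hT)]
    · rw [if_neg hT, if_neg (fun h => (Finset.mem_insert.1 h).elim hne hT)]

/-- **place-by-place induction**: if `x` is trivial at the complex place `w₁` and, at every real place `b` not under `w₁`, the one-place
elements act on `Φ` through `ω` by the inverse of the scalar `χ`, then `χ(x) • ω(x) Φ = Φ`. -/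
theorem smul_apply_eq_self_of_places {X : Type*} [AddCommGroup X] [Module ℂ X]
    (ω : UnitaryGroup.arch (↥(maximalRealSubfield L)) L (IsCMField.complexConj L) N H →* Module.End ℂ X)
    (χ : UnitaryGroup.arch (↥(maximalRealSubfield L)) L (IsCMField.complexConj L) N H →* ℂˣ) (Φ : X)
    (w₁ : {w : InfinitePlace L // w.IsComplex})
    (hstep : ∀ b : {v : InfinitePlace ↥(maximalRealSubfield L) // v.IsReal}, cmPlaceOver L b ≠ w₁ →
      ∀ u : UnitaryGroup.archLocal L N H (cmPlaceOver L b),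
        ((χ (UnitaryGroup.archSingle (↥(maximalRealSubfield L)) L (IsCMField.complexConj L) N H (IsCMField.complexConj_ne_one L)
            (NumberField.complexConj_smul_infinitePlace L) (cmPlaceOver L b) u) : ℂˣ) : ℂ) •
          ω (UnitaryGroup.archSingle (↥(maximalRealSubfield L)) L (IsCMField.complexConj L) N H (IsCMField.complexConj_ne_one L)
            (NumberField.complexConj_smul_infinitePlace L) (cmPlaceOver L b) u) Φ = Φ)
    (x : UnitaryGroup.arch (↥(maximalRealSubfield L)) L (IsCMField.complexConj L) N H)
    (hx1 : UnitaryGroup.archAt (↥(maximalRealSubfield L)) L (IsCMField.complexConj L) N H w₁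
      (NumberField.complexConj_smul_infinitePlace L _) (IsCMField.complexConj_ne_one L) x = 1) :
    ((χ x : ℂˣ) : ℂ) • ω x Φ = Φ := by
  suffices h : ∀ T : Finset {v : InfinitePlace ↥(maximalRealSubfield L) // v.IsReal},
      ((χ (placeTrunc L H x T) : ℂˣ) : ℂ) • ω (placeTrunc L H x T) Φ = Φ by
    simpa only [placeTrunc_univ] using h Finset.univ
  intro T
  induction T using Finset.induction_on with
  | empty => rw [placeTrunc_empty, map_one, map_one, Units.val_one, Module.End.one_apply, one_smul]
  | insert b T hb ih =>
    rw [placeTrunc_insert L H x hb, map_mul, map_mul, Units.val_mul, Module.End.mul_apply, mul_smul, ← map_smul, ih]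
    by_cases hbb : cmPlaceOver L b = w₁
    · subst hbb
      rw [hx1, map_one, map_one, map_one, Units.val_one, Module.End.one_apply, one_smul]
    · exact hstep b hbb _

end PlaceInduction

/-! ## § 4 At the pin: (c5) `harch` of the row-12 term from the TYPE of the line scalar at the definite places -/

section HarchPin

variable {L : CMField} {ι₁ : L →+* ℂ} (V : HermSpace3 L ι₁) (S : StubTree.SeesawDatum L)
variable
  (hGR : (cmSplittingDatum (L : Type) finProdFinEquiv (frameD V) (frameD_real V) (frameD_ne V) (dW S) (dW_real S) (dW_ne S)).CompatibleSplitting)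
  (hGR₀ : (cmSplittingDatum (L : Type) (e₁) (frameD V) (frameD_real V) (frameD_ne V) (lineVec (L : Type) (dW S 0))
    (fun _ => dW_real S 0) (fun _ => dW_ne S 0)).CompatibleSplitting)
  (hGR₁ : (cmSplittingDatum (L : Type) (e₁) (frameD V) (frameD_real V) (frameD_ne V) (lineVec (L : Type) (dW S 1))
    (fun _ => dW_real S 1) (fun _ => dW_ne S 1)).CompatibleSplitting)
  (hGR₂ : (cmSplittingDatum (L : Type) (e₁) (frameD V) (frameD_real V) (frameD_ne V) (lineVec (L : Type) (dW' S 0))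
    (fun _ => dW'_real S 0) (fun _ => dW'_ne S 0)).CompatibleSplitting)
  (hGR₃ : (cmSplittingDatum (L : Type) (e₁) (frameD V) (frameD_real V) (frameD_ne V) (lineVec (L : Type) (dW' S 1))
    (fun _ => dW'_real S 1) (fun _ => dW'_ne S 1)).CompatibleSplitting)
  (η : CMAdelic (L : Type) (frameD V) × CMAdelic (L : Type) (dW S) →* ℂˣ)
  (hV : IsAnisotropic L V.Hm)

/-- **the scalar of line 0 on archimedean elements of `U(diag frameD V)`**: `x ↦ η₀(x^𝔸, 1) · χ₀(x^𝔸, 1)` (its pull-back along the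
`ι₁`-section `archSectionFrameOf V` is #CA3's `lineScalar_zero`). -/
def archScalar_zero : UnitaryGroup.arch (↥(maximalRealSubfield L)) L (IsCMField.complexConj L) 3 (Matrix.diagonal (frameD V)) →* ℂˣ :=
  ((eta₀ V S η).comp (MonoidHom.prod
      (UnitaryGroup.archToAdelic (↥(maximalRealSubfield L)) L (IsCMField.complexConj L) 3 (Matrix.diagonal (frameD V))) 1)) *
    ((cmLineChar₀ (L : Type) finProdFinEquiv e₁ (frameD V) (frameD_real V) (frameD_ne V) (dW S) (dW_real S) (dW_ne S) hGR hGR₀ hGR₁).comp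
      (MonoidHom.prod (UnitaryGroup.archToAdelic (↥(maximalRealSubfield L)) L (IsCMField.complexConj L) 3 (Matrix.diagonal (frameD V))) 1))

/-- (Ported verbatim from the HodgeCMPerL package; no docstring in the source.) -/
theorem archScalar_zero_apply (x : UnitaryGroup.arch (↥(maximalRealSubfield L)) L (IsCMField.complexConj L) 3 (Matrix.diagonal (frameD V))) :
    archScalar_zero V S hGR hGR₀ hGR₁ η x =
      eta₀ V S η (UnitaryGroup.archToAdelic (↥(maximalRealSubfield L)) L (IsCMField.complexConj L) 3 (Matrix.diagonal (frameD V)) x, 1) *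
        cmLineChar₀ (L : Type) finProdFinEquiv e₁ (frameD V) (frameD_real V) (frameD_ne V) (dW S) (dW_real S) (dW_ne S) hGR hGR₀ hGR₁
          (UnitaryGroup.archToAdelic (↥(maximalRealSubfield L)) L (IsCMField.complexConj L) 3 (Matrix.diagonal (frameD V)) x, 1) :=
  rfl

/-- the frame transport of an archimedean regime element is the archimedean element `archFrameCongr` (#CA2). -/
theorem cmFrameEquiv_regime_archToAdelic (a : UnitaryGroup.arch (↥(maximalRealSubfield L)) L (IsCMField.complexConj L) 3 V.Hm) :
    cmFrameEquiv (L : Type) (frameG V) V.Hm (frameD V) (frame_congr V)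
        ((regimeSubgroup L V.Hm).subtype
          (HodgeCM.Adelic.regimeEquiv L V.Hm hV
            (UnitaryGroup.archToAdelic (↥(maximalRealSubfield L)) L (IsCMField.complexConj L) 3 V.Hm a))) =
      UnitaryGroup.archToAdelic (↥(maximalRealSubfield L)) L (IsCMField.complexConj L) 3 (Matrix.diagonal (frameD V))
        (archFrameCongr (L : Type) V.Hm (frameG V) (frameD V) (frame_congr V) a) := by
  rw [Subgroup.coe_subtype, coe_regimeEquiv, archToAdelic_archFrameCongr, cmKTypeHom_apply]
  rfl

/-- **line 0 at an ARCHIMEDEAN regime element**: `lineRepD 0 ((a)^𝔸, 1) = (c₀(a′) • ω_∞((a′, 1))) ⊗ 1`, `a′ = archFrameCongr (frameG V) a`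
(#CA2 `smul_cmPairRep_archToAdelic_eq_adelicTensorEnd` + the line collapse, as in #CA3 for the `ι₁`-section). -/
theorem lineRepD_zero_regime_archToAdelic (a : UnitaryGroup.arch (↥(maximalRealSubfield L)) L (IsCMField.complexConj L) 3 V.Hm) :
    lineRepD V S hGR hGR₀ hGR₁ hGR₂ hGR₃ η 0
        (HodgeCM.Adelic.regimeEquiv L V.Hm hV
          (UnitaryGroup.archToAdelic (↥(maximalRealSubfield L)) L (IsCMField.complexConj L) 3 V.Hm a), 1) =
      adelicTensorEnd
        (((archScalar_zero V S hGR hGR₀ hGR₁ η (archFrameCongr (L : Type) V.Hm (frameG V) (frameD V) (frame_congr V) a) : ℂˣ) : ℂ) •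
          (cmArchWeilRep (L : Type) e₁ (frameD V) (frameD_real V) (frameD_ne V) (lineVec (L : Type) (dW S 0))
            (fun _ => dW_real S 0) (fun _ => dW_ne S 0) hGR₀ (archFrameCongr (L : Type) V.Hm (frameG V) (frameD V) (frame_congr V) a, 1) :
              𝓢((Fin 3 → mixedSpace (↥(maximalRealSubfield L))), ℂ) →ₗ[ℂ] _))
        LinearMap.id := by
  have h1 : lineRepD V S hGR hGR₀ hGR₁ hGR₂ hGR₃ η 0
        (HodgeCM.Adelic.regimeEquiv L V.Hm hV
          (UnitaryGroup.archToAdelic (↥(maximalRealSubfield L)) L (IsCMField.complexConj L) 3 V.Hm a), 1) =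
      cmLineRepFin₀ (L : Type) finProdFinEquiv e₁ (frameD V) (frameD_real V) (frameD_ne V) (dW S) (dW_real S) (dW_ne S)
        hGR hGR₀ hGR₁ (eta₀ V S η)
        (UnitaryGroup.archToAdelic (↥(maximalRealSubfield L)) L (IsCMField.complexConj L) 3 (Matrix.diagonal (frameD V))
          (archFrameCongr (L : Type) V.Hm (frameG V) (frameD V) (frame_congr V) a), 1) := by
    rw [← cmFrameEquiv_regime_archToAdelic V hV a]
    rfl
  have key := smul_cmPairRep_archToAdelic_eq_adelicTensorEnd (L : Type) e₁ (frameD V) (frameD_real V) (frameD_ne V)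
    (lineVec (L : Type) (dW S 0)) (fun _ => dW_real S 0) (fun _ => dW_ne S 0) hGR₀
    ((archScalar_zero V S hGR hGR₀ hGR₁ η (archFrameCongr (L : Type) V.Hm (frameG V) (frameD V) (frame_congr V) a) : ℂˣ) : ℂ)
    (archFrameCongr (L : Type) V.Hm (frameG V) (frameD V) (frame_congr V) a) 1
  rw [map_one] at key
  rw [h1, ← key]
  refine LinearMap.ext fun φ => ?_
  rw [cmLineRepFin₀_apply_eq_smul_cmPairRep, LinearMap.smul_apply, map_one, map_one]
  rfl

/-- (Ported verbatim from the HodgeCMPerL package; no docstring in the source.) -/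
theorem ne_cmPlace_of_cmPlaceOver_ne {b : {v : InfinitePlace ↥(maximalRealSubfield L) // v.IsReal}}
    (hb : cmPlaceOver (L : Type) b ≠ UnitaryGroup.cmPlace (L : Type) ι₁) : b ≠ HypCensus.cmPlace (L : Type) ι₁ :=
  fun h => hb (by rw [h, cmPlaceOver_cmPlace_eq])

/-- the frame transport keeps the `w(ι₁)`-component trivial. -/
theorem archAt_archFrameCongr_eq_one {a : UnitaryGroup.arch (↥(maximalRealSubfield L)) L (IsCMField.complexConj L) 3 V.Hm}
    (ha : UnitaryGroup.archAt (↥(maximalRealSubfield L)) L (IsCMField.complexConj L) 3 V.Hm (UnitaryGroup.cmPlace (L : Type) ι₁)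
      (NumberField.complexConj_smul_infinitePlace (L : Type) _) (IsCMField.complexConj_ne_one (L : Type)) a = 1) :
    UnitaryGroup.archAt (↥(maximalRealSubfield L)) L (IsCMField.complexConj L) 3 (Matrix.diagonal (frameD V)) (UnitaryGroup.cmPlace (L : Type) ι₁)
      (NumberField.complexConj_smul_infinitePlace (L : Type) _) (IsCMField.complexConj_ne_one (L : Type))
      (archFrameCongr (L : Type) V.Hm (frameG V) (frameD V) (frame_congr V) a) = 1 := by
  apply Subtype.ext
  rw [coe_archAt_archFrameCongr, ha, OneMemClass.coe_one, mul_one, inv_mul_cancel, OneMemClass.coe_one]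

variable {S' : Type} [Fintype S'] [DecidableEq S']
  (eR : PosIdx (cmXW (L : Type) (frameD V) (lineVec (L : Type) (dW S 0)) (fun _ => dW_real S 0) ι₁ (HypCensus.cmPlace (L : Type) ι₁)) ≃ Unit)
  (eS : NegIdx (cmXW (L : Type) (frameD V) (lineVec (L : Type) (dW S 0)) (fun _ => dW_real S 0) ι₁ (HypCensus.cmPlace (L : Type) ι₁)) ≃ S')


-- port_pkg: scope closed for this part
end HarchPin
end HodgeCM.Model
end
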